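import Summits.Ventures.PercRepro.RankLevelSetExplicitLin2KeyCube

/-!
# PercRepro — THE CUBE KEY ROW AT `(q, p) = (16, 261 255)`, PART A: chunks 1 … 4 of 16 (p9, S4)

`proofs/SUBCLAIM-S4-p9.md` §S4.2⁗‴. The cube key `KeyC 16 261255 d` (RankLevelSetExplicitLin2KeyCube) at the coranks
`17 … 16400` of the level-16 row at `p = 261 255`, by the kernel (`decide`, four chunks of
4 096); the row is assembled in RankLevelSetExplicitLin2CubeRowSixteen. Axioms: standard.
-/

namespace PercRepro

namespace ThmN

namespace Explicit

/-- The cube key row at `(q, p) = (16, 261 255)`, chunk 1 of 16: coranks `17 … 4112`, by the kernel. -/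
theorem key_sixteen_cube_row_1 : ∀ t < 4096, KeyC 16 261255 (17 + t) := by decide +kernel

/-- The cube key row at `(q, p) = (16, 261 255)`, chunk 2 of 16: coranks `4113 … 8208`, by the kernel. -/
theorem key_sixteen_cube_row_2 : ∀ t < 4096, KeyC 16 261255 (17 + (4096 + t)) := by decide +kernel

/-- The cube key row at `(q, p) = (16, 261 255)`, chunk 3 of 16: coranks `8209 … 12304`, by the kernel. -/
theorem key_sixteen_cube_row_3 : ∀ t < 4096, KeyC 16 261255 (17 + (8192 + t)) := by decide +kernel

/-- The cube key row at `(q, p) = (16, 261 255)`, chunk 4 of 16: coranks `12305 … 16400`, by the kernel. -/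
theorem key_sixteen_cube_row_4 : ∀ t < 4096, KeyC 16 261255 (17 + (12288 + t)) := by decide +kernel

end Explicit

end ThmN

end PercRepro
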